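import Summits.ABC.ABC.Theses.TwistAmplification
import Literature.NumberTheory.EllipticCurves.QuadraticTwistIntegralModel
import Literature.NumberTheory.EllipticCurves.SzpiroLocalDataProofs
import Literature.NumberTheory.EllipticCurves.SzpiroMinimalityProofs

/-!
# Route TwistAmplification — crux `SomeWindowSaving` (stmt-ABC-1976),
  line `polynomial-degree-suffices`: stub `stub_twistSizeTransfer` (T2, twist size transfer)

Let `W₀/ℤ` be an integral Weierstrass model, elliptic over `ℚ` and minimal at every prime, let
`d ≡ 1 (mod 4)` and let `W'/ℤ` be ANY integral model of the quadratic twist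
`E^{(d)} := (W₀ ⊗ ℚ).quadraticTwist d` (`C • E^{(d)} = W' ⊗ ℚ`). Then

`|Δ(W₀)| ≤ |d|⁶ |Δ(W')|` and `|c₄(W₀)| ≤ |d|² |c₄(W')|`.

Proof (Silverman, *AEC* VII.1 with the integral twist model of Connell §4.3 / Comalada 1994):
write `d = 4k + 1` and untwist `W'` integrally: `W'' := W'.twistModel k` is a `ℤ`-model with
`Δ'' = d⁶ Δ'`, `c₄'' = d² c₄'` (`twistModel_Δ`, `twistModel_c₄`), and over `ℚ` it is a model of
`(E^{(d)})^{(d)} ≅ E^{(d²)} ≅ E` (`map_twistModel`, `twistModel_smul`, `twistModel_twistModel`,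
`exists_variableChange_twistModel_eq_quadraticTwist`, `exists_variableChange_quadraticTwist_mul_sq`,
`exists_variableChange_quadraticTwist_one`): `D • (W₀ ⊗ ℚ) = W'' ⊗ ℚ` for some change of variables
`D = (u; r, s, t)` over `ℚ`. Minimality of `W₀` at `v` against the `v`-integral `W'' ⊗ ℚ`
(`valuation_Δ_smul_le_of_isMinimalAt`) gives `|u⁻¹|ᵥ¹² |Δ₀|ᵥ = |Δ''|ᵥ ≤ |Δ₀|ᵥ`, so `|u⁻¹|ᵥ ≤ 1`
at every prime, i.e. `u⁻¹ = m ∈ ℤ ∖ {0}`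
(`IsDedekindDomain.HeightOneSpectrum.mem_integers_of_valuation_le_one`); hence
`Δ'' = m¹² Δ₀`, `c₄'' = m⁴ c₄(W₀)` in `ℤ` (`variableChange_Δ`, `variableChange_c₄`) and
`|Δ₀| ≤ |Δ''| = |d|⁶ |Δ'|`, `|c₄(W₀)| ≤ |c₄''| = |d|² |c₄'|`.

Everything used is PROVED in the tree / Mathlib (no named-fact hypothesis). Lands
`--supports stmt-ABC-1976`.
-/

-- `Summit.<Summit>.<Problem>` is the mandated summit-side namespace (CONVENTIONS §2); for the
-- single-conjunct summit `ABC` the two coincide, so the duplicate `ABC.ABC` is deliberate.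
set_option linter.dupNamespace false

namespace Summit.ABC.ABC.Theorems

open WeierstrassCurve IsDedekindDomain

namespace TwistSizeTransfer

/-- Base change to `ℚ` commutes with the integral twist model:
`(W₁.twistModel k) ⊗ ℚ = (W₁ ⊗ ℚ).twistModel k` (`map_twistModel`). [folklore] -/
theorem baseChange_twistModel (W₁ : WeierstrassCurve ℤ) (k : ℤ) :
    (W₁.twistModel k).baseChange ℚ = (W₁.baseChange ℚ).twistModel (k : ℚ) := by
  simp only [baseChange, map_twistModel, eq_intCast]

/-- **Integral untwisting.** If `W'/ℤ` is a model of the quadratic twist of `E := W₀ ⊗ ℚ` by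
`d = 4k + 1` (`C • E^{(d)} = W' ⊗ ℚ`), then the integral twist model `W'.twistModel k` is a
`ℤ`-model of `E` itself: `D • E = (W'.twistModel k) ⊗ ℚ` for some change of variables `D` over `ℚ`
(`(E^{(d)})^{(d)} = E^{(d²)} ≅ E^{(1)} ≅ E`; Silverman, *AEC* X.5 Cor. 5.4). [folklore] -/
theorem exists_smul_eq_baseChange_twistModel {W₀ W' : WeierstrassCurve ℤ} {k : ℤ}
    {C : VariableChange ℚ}
    (hC : C • (W₀.baseChange ℚ).quadraticTwist ((4 * k + 1 : ℤ) : ℚ) = W'.baseChange ℚ) :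
    ∃ D : VariableChange ℚ, D • W₀.baseChange ℚ = (W'.twistModel k).baseChange ℚ := by
  have hd0 : (4 * (k : ℚ) + 1) ≠ 0 := by exact_mod_cast (show (4 * k + 1 : ℤ) ≠ 0 by omega)
  have hC' : C • (W₀.baseChange ℚ).quadraticTwist (4 * (k : ℚ) + 1) = W'.baseChange ℚ := by
    push_cast at hC; exact hC
  obtain ⟨C₁, -, hC₁⟩ :=
    exists_variableChange_twistModel_eq_quadraticTwist (W₀.baseChange ℚ) (k : ℚ)
  obtain ⟨C₂, -, hC₂⟩ :=
    exists_variableChange_twistModel_eq_quadraticTwist (W₀.baseChange ℚ) (4 * (k : ℚ) * k + k + k)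
  obtain ⟨C₄, hC₄⟩ := exists_variableChange_quadraticTwist_mul_sq (W₀.baseChange ℚ) 1 _ hd0
  obtain ⟨C₅, hC₅⟩ := exists_variableChange_quadraticTwist_one (W₀.baseChange ℚ)
  have hsq : (1 * (4 * (k : ℚ) + 1) ^ 2) = 4 * (4 * (k : ℚ) * k + k + k) + 1 := by ring
  have h1 : W'.baseChange ℚ = (C * C₁) • (W₀.baseChange ℚ).twistModel (k : ℚ) := by
    rw [mul_smul, hC₁, hC']
  have h2 : (W₀.baseChange ℚ).twistModel (4 * (k : ℚ) * k + k + k) =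
      (C₂⁻¹ * (C₄ * C₅)) • W₀.baseChange ℚ := by
    rw [mul_smul, mul_smul, hC₅, hC₄, hsq, ← hC₂, inv_smul_smul]
  refine ⟨VariableChange.twistMap (k : ℚ) (C * C₁) * (C₂⁻¹ * (C₄ * C₅)), ?_⟩
  rw [baseChange_twistModel, h1, twistModel_smul, twistModel_twistModel, h2, ← mul_smul]

/-- **Minimality bounds the scaling.** If `W₀ ⊗ ℚ` is elliptic and minimal at `v`, and
`D • (W₀ ⊗ ℚ) = W₁ ⊗ ℚ` for an integral `W₁/ℤ`, then `|u⁻¹|ᵥ ≤ 1` for the scaling `u` of `D`: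
`|u⁻¹|ᵥ¹² |Δ₀|ᵥ = |Δ₁|ᵥ ≤ |Δ₀|ᵥ ≠ 0` (Silverman, *AEC* VII.1, definition of minimality and
Prop. 1.3). [folklore] -/
theorem valuation_u_inv_le_one {W₀ W₁ : WeierstrassCurve ℤ} [(W₀.baseChange ℚ).IsElliptic]
    (v : HeightOneSpectrum ℤ) (hmin : (W₀.baseChange ℚ).IsMinimalAt v) {D : VariableChange ℚ}
    (hD : D • W₀.baseChange ℚ = W₁.baseChange ℚ) :
    v.valuation ℚ ((D.u⁻¹ : ℚˣ) : ℚ) ≤ 1 := by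
  have hint : (D • W₀.baseChange ℚ).IsIntegralAt v := by
    rw [hD]; exact isIntegralAt_baseChange_int v W₁
  have hle := valuation_Δ_smul_le_of_isMinimalAt v hmin D hint
  rw [variableChange_Δ, map_mul, map_pow] at hle
  have hΔ0 : v.valuation ℚ (W₀.baseChange ℚ).Δ ≠ 0 :=
    (Valuation.ne_zero_iff _).mpr (W₀.baseChange ℚ).isUnit_Δ.ne_zero
  have h12 : v.valuation ℚ ((D.u⁻¹ : ℚˣ) : ℚ) ^ 12 ≤ 1 := by
    have h := mul_le_mul_left hle (v.valuation ℚ (W₀.baseChange ℚ).Δ)⁻¹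
    rwa [mul_assoc, mul_inv_cancel₀ hΔ0, mul_one] at h
  exact (pow_le_one_iff (by norm_num)).mp h12

/-- **The scaling is an integer.** If `W₀ ⊗ ℚ` is elliptic and minimal at every prime and
`D • (W₀ ⊗ ℚ) = W₁ ⊗ ℚ` for an integral `W₁/ℤ`, then `u⁻¹ ∈ ℤ` for the scaling `u` of `D`
(an element of `ℚ` that is integral at every prime is an integer). [folklore] -/
theorem exists_intCast_eq_u_inv {W₀ W₁ : WeierstrassCurve ℤ} [(W₀.baseChange ℚ).IsElliptic]
    (hmin : ∀ v : HeightOneSpectrum ℤ, (W₀.baseChange ℚ).IsMinimalAt v) {D : VariableChange ℚ}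
    (hD : D • W₀.baseChange ℚ = W₁.baseChange ℚ) :
    ∃ m : ℤ, (m : ℚ) = ((D.u⁻¹ : ℚˣ) : ℚ) := by
  obtain ⟨m, hm⟩ := RingHom.mem_range.mp
    (HeightOneSpectrum.mem_integers_of_valuation_le_one ℚ ((D.u⁻¹ : ℚˣ) : ℚ)
      fun v ↦ valuation_u_inv_le_one v (hmin v) hD)
  exact ⟨m, by rw [← hm, eq_intCast]⟩

/-- Transport of `Δ` and `c₄` along `D • (W₀ ⊗ ℚ) = W₁ ⊗ ℚ` with integral scaling `u⁻¹ = m`: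
`Δ₁ = m¹² Δ₀` and `c₄(W₁) = m⁴ c₄(W₀)` in `ℤ` (`variableChange_Δ`, `variableChange_c₄`;
Silverman, *AEC* III.1 Table 3.1). [folklore] -/
theorem Δ_c₄_eq_of_smul_eq {W₀ W₁ : WeierstrassCurve ℤ} {D : VariableChange ℚ}
    (hD : D • W₀.baseChange ℚ = W₁.baseChange ℚ) {m : ℤ} (hm : (m : ℚ) = ((D.u⁻¹ : ℚˣ) : ℚ)) :
    W₁.Δ = m ^ 12 * W₀.Δ ∧ W₁.c₄ = m ^ 4 * W₀.c₄ := by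
  have hΔ := congrArg WeierstrassCurve.Δ hD
  have hc := congrArg WeierstrassCurve.c₄ hD
  rw [variableChange_Δ, baseChange_int_Δ, baseChange_int_Δ, ← hm] at hΔ
  rw [variableChange_c₄, baseChange_int_c₄, baseChange_int_c₄, ← hm] at hc
  exact ⟨by exact_mod_cast hΔ.symm, by exact_mod_cast hc.symm⟩

/-- If `a = mⁿ b` in `ℤ` with `m ≠ 0` then `|b| ≤ |a|`. [folklore] -/
theorem abs_le_abs_of_eq_pow_mul {a b m : ℤ} {n : ℕ} (hm : m ≠ 0) (h : a = m ^ n * b) :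
    |b| ≤ |a| := by
  rw [h, abs_mul, abs_pow]
  exact le_mul_of_one_le_left (abs_nonneg _) (one_le_pow₀ (Int.one_le_abs hm))

end TwistSizeTransfer

open TwistSizeTransfer in
/-- **Stub T2 of the line `polynomial-degree-suffices` (twist size transfer).** For an integral
model `W₀/ℤ`, elliptic over `ℚ` and minimal at every prime, `d ≡ 1 (mod 4)`, and ANY integral model
`W'/ℤ` of the quadratic twist `(W₀ ⊗ ℚ)^{(d)}` (`C • (W₀ ⊗ ℚ).quadraticTwist d = W' ⊗ ℚ`):
`|Δ(W₀)| ≤ |d|⁶ |Δ(W')|` and `|c₄(W₀)| ≤ |d|² |c₄(W')|`. Proof: untwist `W'` integrally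
(`W'.twistModel k`, `d = 4k+1`, a `ℤ`-model of `W₀ ⊗ ℚ` with `Δ ↦ d⁶Δ'`, `c₄ ↦ d²c₄'`) and compare
with the minimal `W₀`: the relating scaling is `u⁻¹ = m ∈ ℤ ∖ {0}`, `d⁶Δ' = m¹²Δ₀`, `d²c₄' = m⁴c₄(W₀)`
(Silverman, *AEC* VII.1, X.5 Cor. 5.4; Connell, *Elliptic Curve Handbook* §4.3). [folklore] -/
theorem stub_twistSizeTransfer :
    ∀ (W₀ W' : WeierstrassCurve ℤ), (W₀.baseChange ℚ).IsElliptic →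
      (∀ v : HeightOneSpectrum ℤ, (W₀.baseChange ℚ).IsMinimalAt v) →
        ∀ (d : ℤ) (C : WeierstrassCurve.VariableChange ℚ), d ≡ 1 [ZMOD 4] →
          C • (W₀.baseChange ℚ).quadraticTwist (d : ℚ) = W'.baseChange ℚ →
            |W₀.Δ| ≤ |d| ^ 6 * |W'.Δ| ∧ |W₀.c₄| ≤ |d| ^ 2 * |W'.c₄| := by
  intro W₀ W' _ hmin d C hd hC
  obtain ⟨k, rfl⟩ : ∃ k, d = 4 * k + 1 := by
    obtain ⟨c, hc⟩ := Int.modEq_iff_dvd.mp hd.symm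
    exact ⟨c, by omega⟩
  obtain ⟨D, hD⟩ := exists_smul_eq_baseChange_twistModel hC
  obtain ⟨m, hm⟩ := exists_intCast_eq_u_inv hmin hD
  have hm0 : m ≠ 0 := by
    rintro rfl
    exact (D.u⁻¹).ne_zero (by exact_mod_cast hm.symm)
  obtain ⟨hΔ, hc₄⟩ := Δ_c₄_eq_of_smul_eq hD hm
  rw [twistModel_Δ] at hΔ
  rw [twistModel_c₄] at hc₄
  refine ⟨?_, ?_⟩
  · have h := abs_le_abs_of_eq_pow_mul hm0 hΔ
    rwa [abs_mul, abs_pow] at h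
  · have h := abs_le_abs_of_eq_pow_mul hm0 hc₄
    rwa [abs_mul, abs_pow] at h

end Summit.ABC.ABC.Theorems
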